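import Literature.NumberTheory.Transcendental.RoySmallValueMainA
import Literature.NumberTheory.Transcendental.RoySmallValueTransport
import HarnessLib

/-!
# Roy's small value estimate for `𝔾ₐ × 𝔾ₘ` — proof of Theorem 1.1, part C: the orbit `Z_D` and the point `α₀`

Topic `Literature/NumberTheory/Transcendental`. Part of the formalisation of the proof of Roy 2013,
Theorem 1.1 (named fact `roy2013_thm_1_1`, `RoySmallValueEstimates.lean`). Source: D. Roy,
*A small value estimate for `𝔾ₐ × 𝔾ₘ`*, Mathematika 59 (2013) 333–363 = arXiv:1301.0663, §7,
Step 2 (p. 18 of the arXiv text):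

> Thus, there exists a `0`-dimensional subvariety `Z = Z_D` of `ℙ²_ℚ` contained in
> `𝒵(𝒟ⁱP̃_D ; 0 ≤ i < 2T)` such that `h_{𝒞_D}(Z) ≤ −(D^δ/25)(2D^β deg(Z) + D h(Z))`. [...]
> `∑_{α∈𝒰} max{T log dist(α,(1:γ)), log dist(α,A_γ)} ≤ −(D^δ/25)(D^β deg(Z) + D h(Z))` [...]
> In particular, the set `𝒰` is not empty and contains at least one point `α₀` for which
> `log dist(α₀,(1:γ)) ≤ −D^{δ+β}/(25T)`.

At a good degree `D` (`Setting.Good`) we obtain: the orbit `O = Z.orb i₀` with the product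
inequality (`step2_out`, from `step2_level`), the vanishing on `O` of every integer form of `𝒞_D`
(`vanish`), in particular of `𝒟ʲP̃_D`, `j < 2T_D` (`iterate_Pc_vanish`), the positivity of
`dist(α_j^u,(1:γ))` on `O` (`pdist_pos`, non-algebraicity + `exists_pdist_lower_bound`), the
display over `𝒰` (`step2_h2`, from `step2_sums`, `log_Θ_le` and the side condition `herr`), the
existence of `α₀ ∈ 𝒰` with `T log dist(α₀^u,(1:γ)) ≤ −(κ/2) D^{δ+β}` (`exists_close_point`), and
that rational special points cannot lie in `O` (`not_special_of_mem_orb`). Everything is proved;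
no new definitions besides abbreviations; no named facts.

## References

* [Roy2013] D. Roy, *A small value estimate for 𝔾ₐ × 𝔾ₘ*, Mathematika 59 (2013), 333–363
  (arXiv:1301.0663), §7, Step 2.
-/

noncomputable section

open MvPolynomial Finset Filter NumberField Height

namespace Literature.NumberTheory.Transcendental

namespace Roy2013

open Nesterenko

/-! ### Unit representatives of special points, and their orbits -/

/-- The unit representative has sup norm `1`. [folklore] -/
theorem norm_unitRep {α : Fin 3 → ℂ} (hα : α ≠ 0) : ‖unitRep α‖ = 1 := by
  have h0 : 0 < ‖α‖ := norm_pos_iff.mpr hα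
  rw [unitRep, norm_smul, Complex.norm_real, Real.norm_of_nonneg (inv_nonneg.mpr h0.le),
    inv_mul_cancel₀ h0.ne']

/-- A vector of sup norm `1` is its own unit representative. [folklore] -/
theorem unitRep_of_norm_eq_one {α : Fin 3 → ℂ} (h : ‖α‖ = 1) : unitRep α = α := by
  rw [unitRep, h, inv_one, Complex.ofReal_one, one_smul]

/-- The special points have norm `1`. [folklore] -/
theorem norm_special {α : Fin 3 → ℂ} (h : α = ![0, 1, 0] ∨ α = ![0, 0, 1]) : ‖α‖ = 1 := by
  rcases h with rfl | rfl
  · refine le_antisymm ((pi_norm_le_iff_of_nonneg zero_le_one).mpr fun i => ?_) ?_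
    · fin_cases i <;> simp
    · simpa using norm_le_pi_norm (![(0 : ℂ), 1, 0]) 1
  · refine le_antisymm ((pi_norm_le_iff_of_nonneg zero_le_one).mpr fun i => ?_) ?_
    · fin_cases i <;> simp
    · simpa using norm_le_pi_norm (![(0 : ℂ), 0, 1]) 2

namespace ZeroConfigK

variable {K : IntermediateField ℚ ℂ} [NumberField K] {m : ℕ} (Z : ZeroConfigK K (Fin m))

omit [NumberField K] in
/-- **A special (rational) point is fixed by every automorphism**, so its orbit is a singleton.
[cite: Roy2013, §6, proof of Prop. 6.4 ("In the latter case, we have `deg(Z) = 1`")] -/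
theorem perm_eq_self_of_special {j : Fin m} (h : Z.α j = ![0, 1, 0] ∨ Z.α j = ![0, 0, 1])
    (g : K ≃ₐ[ℚ] K) : Z.perm g j = j := by
  rw [Z.perm_eq_iff]
  have hcoord : ∀ k, Z.α j k = 0 ∨ Z.α j k = 1 := by
    intro k; rcases h with h | h <;> rw [h] <;> fin_cases k <;> simp
  funext k
  change ((g (Z.rep j k) : K) : ℂ) = Z.α j k
  rcases hcoord k with h0 | h1
  · have : Z.rep j k = 0 := Subtype.ext h0
    rw [this, map_zero, h0]; rfl
  · have : Z.rep j k = 1 := Subtype.ext h1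
    rw [this, map_one, h1]; rfl

/-- The orbit of a special point is a singleton. [folklore] -/
theorem orb_eq_singleton_of_special {j : Fin m} (h : Z.α j = ![0, 1, 0] ∨ Z.α j = ![0, 0, 1]) :
    Z.orb j = {j} := by
  classical
  ext x
  simp only [ZeroConfigK.orb, mem_filter, mem_univ, true_and, mem_singleton]
  constructor
  · rintro ⟨g, rfl⟩; exact Z.perm_eq_self_of_special h g
  · intro hx; rw [hx]; exact ⟨1, Z.perm_one _⟩

/-- **Special points do not lie in an orbit containing a point of `𝒰`.**
[cite: Roy2013, §7, Step 3 (all points of `Z` in `𝒢`) via Step 2 (`α₀ ∈ 𝒰`)] -/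
theorem not_special_of_mem_orb {ξ η : ℂ} {i₀ j j₀ : Fin m} (hj : j ∈ Z.orb i₀) (hj₀ : j₀ ∈ Z.orb i₀)
    (hU : pdist ξ η (unitRep (Z.α j₀)) ≤ (2 * roy_c2 ξ η)⁻¹) :
    ¬(Z.α j = ![0, 1, 0] ∨ Z.α j = ![0, 0, 1]) := by
  intro h
  have h1 : Z.orb i₀ = {j} := by rw [← Z.orb_eq_of_mem hj]; exact Z.orb_eq_singleton_of_special h
  rw [h1, mem_singleton] at hj₀
  subst hj₀
  rw [unitRep_of_norm_eq_one (norm_special h)] at hU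
  exact not_pdist_le_of_special ξ η h hU

end ZeroConfigK

namespace Setting

variable (S : Setting)

/-! ### Step 2 at a good degree -/

/-- **The orbit `Z_D`.** At a good degree there is `i₀` such that every family of test forms of
`𝒞_D` indexed by `O = Z.orb i₀` has product `≤ Θ = ε^{w_O/B_w}`.
[cite: Roy2013, §7, Step 2 (existence of `Z = Z_D`)] -/
theorem step2_out {D : ℕ} (hG : S.Good D) :
    ∃ i₀ : Fin (S.pkg D hG.hD₁).m, ∀ t : Fin (S.pkg D hG.hD₁).m → CX,
      (∀ j ∈ (S.Zc D hG.hD₁).orb i₀, t j ∈ S.body D) →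
      ∏ j ∈ (S.Zc D hG.hD₁).orb i₀, (‖eval ((S.Zc D hG.hD₁).α j) (t j)‖ / ‖(S.Zc D hG.hD₁).α j‖ ^ D *
        Real.exp (D * hgtK (S.Zc D hG.hD₁) j)) ≤ S.Θ D hG.hD₁ i₀ := by
  have hP := S.Pc_mem_body hG.hD₁ hG.hA1 hG.hA2
  have hQ := S.Q_mem_body hG.hD₁ hG.hA3 hG.hA4
  have hε1 : (2 : ℝ) ^ (2 * kexp D * 2 ^ kexp D) * (Real.exp (-(S.T D * S.U D)) *
      ((Fintype.card (PhiRow D)).factorial * (3 * Real.exp (S.Y D)) ^ Fintype.card (PhiRow D))) < 1 := by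
    have h := hG.ε_lt_one
    rw [Setting.εlev, Setting.Nrow, ← card_finsuppAntidiag_fin_three (3 * D)] at h
    exact h
  obtain ⟨i₀, hi₀⟩ := step2_level (Pt := S.Ptil D) (ξ := S.ξ) (η := S.η) (T := S.T D) (Y := S.Y D)
    (U := S.U D) S.hη (S.pkg D hG.hD₁) (K := S.Kfld D) (S.mem_Kfld hG.hD₁ le_rfl) hG.one_le
    (S.T_le_choose D) hG.L_lt.le (S.U_nonneg D) hG.hYc (S.Y_pos hG.one_le) hP hQ (kexp D)
    (sq_le_two_pow D) hε1
  refine ⟨i₀, fun t ht => ?_⟩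
  have h := hi₀ t ht
  rw [Setting.Θ, Setting.εlev, Setting.wO, Setting.Bw, Setting.Nrow, ← card_finsuppAntidiag_fin_three (3 * D)]
  exact h

/-- **Integer forms of `𝒞_D` vanish on `Z_D`.** [cite: Roy2013, §7, Step 2
("`Z ⊆ 𝒵(𝒟ⁱP̃_D ; 0 ≤ i < 2T)`")] -/
theorem vanish {D : ℕ} (hG : S.Good D) {i₀ : Fin (S.pkg D hG.hD₁).m}
    (hO : ∀ t : Fin (S.pkg D hG.hD₁).m → CX, (∀ j ∈ (S.Zc D hG.hD₁).orb i₀, t j ∈ S.body D) →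
      ∏ j ∈ (S.Zc D hG.hD₁).orb i₀, (‖eval ((S.Zc D hG.hD₁).α j) (t j)‖ / ‖(S.Zc D hG.hD₁).α j‖ ^ D *
        Real.exp (D * hgtK (S.Zc D hG.hD₁) j)) ≤ S.Θ D hG.hD₁ i₀)
    {Pz : MvPolynomial (Fin 3) ℤ} (hPz : map (Int.castRingHom ℂ) Pz ∈ S.body D) :
    ∀ j ∈ (S.Zc D hG.hD₁).orb i₀, eval ((S.Zc D hG.hD₁).α j) (map (Int.castRingHom ℂ) Pz) = 0 :=
  vanish_on_orbit (S.pkg D hG.hD₁) (S.mem_Kfld hG.hD₁ le_rfl) (S.εlev_pos D) hG.ε_lt_one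
    (S.Y_pos hG.one_le) hO hPz

/-- **`𝒟ʲP̃_D` vanish on `Z_D` for `j < 2T_D`.** [cite: Roy2013, §7, Step 2] -/
theorem iterate_Pc_vanish {D : ℕ} (hG : S.Good D) {i₀ : Fin (S.pkg D hG.hD₁).m}
    (hO : ∀ t : Fin (S.pkg D hG.hD₁).m → CX, (∀ j ∈ (S.Zc D hG.hD₁).orb i₀, t j ∈ S.body D) →
      ∏ j ∈ (S.Zc D hG.hD₁).orb i₀, (‖eval ((S.Zc D hG.hD₁).α j) (t j)‖ / ‖(S.Zc D hG.hD₁).α j‖ ^ D *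
        Real.exp (D * hgtK (S.Zc D hG.hD₁) j)) ≤ S.Θ D hG.hD₁ i₀)
    {j : ℕ} (hj : j < 2 * S.T D) :
    ∀ x ∈ (S.Zc D hG.hD₁).orb i₀, aeval ((S.Zc D hG.hD₁).α x) (homD^[j] (S.Pc D)) = 0 := by
  intro x hx
  have hmem := S.iterate_Pc_mem_body hG.hD₀ hG.one_le hG.hA1 hG.hA2 hj
  have h1 : homD^[j] (S.Pc D) = map (Int.castRingHom ℂ) ((homDK ℤ)^[j] (S.Ptil D)) := by
    rw [map_iterate_homDK]
  rw [h1] at hmem ⊢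
  exact S.vanish hG hO hmem x hx

/-! ### Positivity of the distances -/

/-- **`dist(α_j^u, (1:γ)) > 0`** for the points of the configuration of a good degree
(indeed bounded below by a constant of the degree): otherwise `(1:γ)` would be a common zero of
the rational forms `P̃_D, Q_D`, hence algebraic. [cite: Roy2013, §7, Step 2 ("distinct from
`(1:γ)` because `(1:γ) ∉ ℙ²(ℚ̄)`")] -/
theorem exists_pdist_lower (D : ℕ) (h1 : S.D₁ ≤ D) :
    ∃ ε : ℝ, 0 < ε ∧ ∀ j : Fin (S.pkg D h1).m, ε ≤ pdist S.ξ S.η (unitRep ((S.pkg D h1).α j)) := by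
  have h : S.D₀ ≤ D := le_trans (le_max_left _ _) h1
  set 𝓛 := S.pkg D h1 with h𝓛
  have hPt := S.isHomogeneous_Pc h
  have hPq : (map (Int.castRingHom ℚ) (S.Ptil D)).IsHomogeneous D := isHomogeneous_map_rat hPt
  have hQc := isHomogeneous_map_levelQ hPt 𝓛.t
  have hQq : (map (Int.castRingHom ℚ) (levelQ D (S.Ptil D) 𝓛.t)).IsHomogeneous D := isHomogeneous_map_rat hQc
  obtain ⟨ε, hε, hεle⟩ := exists_pdist_lower_bound S.hnot hPq hQq
    (by rw [toCX_map_int]; exact S.Pc_ne_zero h) (by rw [toCX_map_int]; exact 𝓛.hQ0)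
    (by rw [toCX_map_int, toCX_map_int]; exact isRelPrime_of_regular (S.Pc_ne_zero h) 𝓛.hPQ)
  have hs : ∀ j, ((‖𝓛.α j‖⁻¹ : ℝ) : ℂ) ≠ 0 := fun j =>
    Complex.ofReal_ne_zero.mpr (inv_ne_zero (norm_ne_zero_iff.mpr (𝓛.α_ne_zero j)))
  refine ⟨ε, hε, fun j => hεle _ (norm_unitRep (𝓛.α_ne_zero j)) ?_ ?_⟩
  · rw [toCX_map_int, unitRep, eval_smul_eq_zero_iff hPt (hs j)]
    exact (𝓛.zero j).1
  · rw [toCX_map_int, unitRep, eval_smul_eq_zero_iff hQc (hs j)]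
    exact (𝓛.zero j).2

/-- `dist(α_j^u, (1:γ)) > 0`. [folklore] -/
theorem pdist_pos (D : ℕ) (h1 : S.D₁ ≤ D) (j : Fin (S.pkg D h1).m) :
    0 < pdist S.ξ S.η (unitRep ((S.pkg D h1).α j)) := by
  obtain ⟨ε, hε, hle⟩ := S.exists_pdist_lower D h1
  exact lt_of_lt_of_le hε (hle j)

/-! ### The display over `𝒰` and the point `α₀` -/

/-- **Roy 2013, Step 2 — the display over `𝒰` at a good degree**:
`∑_{j∈𝒰} max{T a_j, b_j} ≤ −(κ/2) D^δ (D^β #O + D H_O)`. [cite: Roy2013, §7, Step 2 (last display)] -/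
theorem step2_h2 {D : ℕ} (hG : S.Good D) {i₀ : Fin (S.pkg D hG.hD₁).m}
    (hO : ∀ t : Fin (S.pkg D hG.hD₁).m → CX, (∀ j ∈ (S.Zc D hG.hD₁).orb i₀, t j ∈ S.body D) →
      ∏ j ∈ (S.Zc D hG.hD₁).orb i₀, (‖eval ((S.Zc D hG.hD₁).α j) (t j)‖ / ‖(S.Zc D hG.hD₁).α j‖ ^ D *
        Real.exp (D * hgtK (S.Zc D hG.hD₁) j)) ≤ S.Θ D hG.hD₁ i₀)
    (b : Fin (S.pkg D hG.hD₁).m → ℝ)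
    (hb0 : ∀ j ∈ (S.Zc D hG.hD₁).orb i₀,
      pdist S.ξ S.η (unitRep ((S.Zc D hG.hD₁).α j)) ≤ (2 * roy_c2 S.ξ S.η)⁻¹ →
      adist S.ξ S.η (unitRep ((S.Zc D hG.hD₁).α j)) = 0 →
      b j ≤ S.T D * Real.log (pdist S.ξ S.η (unitRep ((S.Zc D hG.hD₁).α j))))
    (hb1 : ∀ j ∈ (S.Zc D hG.hD₁).orb i₀,
      pdist S.ξ S.η (unitRep ((S.Zc D hG.hD₁).α j)) ≤ (2 * roy_c2 S.ξ S.η)⁻¹ →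
      adist S.ξ S.η (unitRep ((S.Zc D hG.hD₁).α j)) ≠ 0 →
      b j = Real.log (adist S.ξ S.η (unitRep ((S.Zc D hG.hD₁).α j)))) :
    ∑ j ∈ ((S.Zc D hG.hD₁).orb i₀).filter
        (fun j => pdist S.ξ S.η (unitRep ((S.Zc D hG.hD₁).α j)) ≤ (2 * roy_c2 S.ξ S.η)⁻¹),
        max (S.T D * Real.log (pdist S.ξ S.η (unitRep ((S.Zc D hG.hD₁).α j)))) (b j) ≤
      -(κ / 2 * (D : ℝ) ^ S.δ * ((D : ℝ) ^ S.β * ((S.Zc D hG.hD₁).orb i₀).card +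
        D * ∑ j ∈ (S.Zc D hG.hD₁).orb i₀, hgtK (S.Zc D hG.hD₁) j)) := by
  have hsum := step2_sums (S.Zc D hG.hD₁) (U := S.U D) S.hη (S.choose_lt_T hG.one_le) (S.T_le_choose D) hG.hL
    (S.le_T D) (S.k45_spec D) (S.Y_pos hG.one_le).le i₀ hO (fun j _ => S.pdist_pos D hG.hD₁ j) b hb0 hb1
  have hlog := S.log_Θ_le hG i₀
  have herr := hG.herr
  have hd : (0 : ℝ) ≤ ((S.Zc D hG.hD₁).orb i₀).card := Nat.cast_nonneg _
  have hD0 : (0 : ℝ) < D := by exact_mod_cast lt_of_lt_of_le one_pos hG.one_le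
  have hs : 0 ≤ ∑ j ∈ (S.Zc D hG.hD₁).orb i₀, hgtK (S.Zc D hG.hD₁) j :=
    Finset.sum_nonneg fun j _ => hgtK_nonneg _ j
  have hδ : 0 ≤ (D : ℝ) ^ S.δ := by positivity
  have hβ : 0 ≤ (D : ℝ) ^ S.β := by positivity
  have herr' : errStep2 S.ξ S.η (S.T D) (S.k45 D) * ((S.Zc D hG.hD₁).orb i₀).card ≤
      κ / 2 * (D : ℝ) ^ S.δ * (D : ℝ) ^ S.β * ((S.Zc D hG.hD₁).orb i₀).card :=
    mul_le_mul_of_nonneg_right herr hd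
  rw [Setting.κ] at *
  nlinarith [mul_nonneg hδ (mul_nonneg hD0.le hs), mul_nonneg hδ (mul_nonneg hβ hd)]

/-- **The point `α₀`**: `𝒰` contains `j₀` with `T log dist(α_{j₀}^u,(1:γ)) ≤ −(κ/2) D^{δ+β}`.
[cite: Roy2013, §7, Step 2 ("contains at least one point `α₀` for which
`log dist(α₀,(1:γ)) ≤ −D^{δ+β}/(25T)`")] -/
theorem exists_close_point {D : ℕ} (hG : S.Good D) {i₀ : Fin (S.pkg D hG.hD₁).m}
    (hO : ∀ t : Fin (S.pkg D hG.hD₁).m → CX, (∀ j ∈ (S.Zc D hG.hD₁).orb i₀, t j ∈ S.body D) →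
      ∏ j ∈ (S.Zc D hG.hD₁).orb i₀, (‖eval ((S.Zc D hG.hD₁).α j) (t j)‖ / ‖(S.Zc D hG.hD₁).α j‖ ^ D *
        Real.exp (D * hgtK (S.Zc D hG.hD₁) j)) ≤ S.Θ D hG.hD₁ i₀) :
    ∃ j₀ ∈ ((S.Zc D hG.hD₁).orb i₀).filter
        (fun j => pdist S.ξ S.η (unitRep ((S.Zc D hG.hD₁).α j)) ≤ (2 * roy_c2 S.ξ S.η)⁻¹),
      S.T D * Real.log (pdist S.ξ S.η (unitRep ((S.Zc D hG.hD₁).α j₀))) ≤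
        -(κ / 2 * (D : ℝ) ^ S.δ * (D : ℝ) ^ S.β) := by
  classical
  have h2 := S.step2_h2 hG hO (fun j => if adist S.ξ S.η (unitRep ((S.Zc D hG.hD₁).α j)) = 0 then
      S.T D * Real.log (pdist S.ξ S.η (unitRep ((S.Zc D hG.hD₁).α j)))
      else Real.log (adist S.ξ S.η (unitRep ((S.Zc D hG.hD₁).α j))))
    (fun j _ _ h0 => by show (if _ then _ else _) ≤ _; rw [if_pos h0])
    (fun j _ _ h1 => by show (if _ then _ else _) = _; rw [if_neg h1])
  have hD0 : (0 : ℝ) < D := by exact_mod_cast lt_of_lt_of_le one_pos hG.one_le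
  have hd0 : (0 : ℝ) < ((S.Zc D hG.hD₁).orb i₀).card := by
    exact_mod_cast Finset.card_pos.mpr ⟨i₀, (S.Zc D hG.hD₁).self_mem_orb i₀⟩
  have hs : 0 ≤ ∑ j ∈ (S.Zc D hG.hD₁).orb i₀, hgtK (S.Zc D hG.hD₁) j :=
    Finset.sum_nonneg fun j _ => hgtK_nonneg _ j
  have hM : 0 < κ / 2 * (D : ℝ) ^ S.δ * (D : ℝ) ^ S.β := by rw [Setting.κ]; positivity
  refine exists_le_of_sum_le_neg _ (fun j => (S.T D : ℝ) * Real.log (pdist S.ξ S.η (unitRep ((S.Zc D hG.hD₁).α j))))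
    hM hd0 (by exact_mod_cast Finset.card_filter_le _ _) ?_
  refine le_trans (Finset.sum_le_sum fun j _ => le_max_left _ _) (h2.trans ?_)
  rw [Setting.κ] at *
  have hδ : 0 ≤ (D : ℝ) ^ S.δ := by positivity
  nlinarith [mul_nonneg hδ (mul_nonneg hD0.le hs)]

end Setting

end Roy2013

end Literature.NumberTheory.Transcendental
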